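import Literature.NumberTheory.EllipticCurves.RankinSymmSquarePairSeries
import Literature.NumberTheory.EllipticCurves.NewformSymmSquareJ0Hecke
import HarnessLib

/-!
# Murty's bound `(f, f) ≫ N^{1−ε}` from ONE analytic statement about the explicit pair function
# `P = symmSqPairL f_i f_j` (continuation and growth), plus the CM family `j = 0`

Topic `NumberTheory/EllipticCurves`; namespace `Literature.NumberTheory.EllipticCurves.ModularForms`.
A proofs-only file (theorems only; no definition, no named fact; D-0026) in support of the named fact
`murty_petersson_newform_lower_bound` (`NewformPeterssonSize`; Murty 1999 §2 (3) ⇐ Hoffstein–Lockhart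
1994, Thm. 0.1).

`NewformPeterssonSizePairReductionProofs` / `NewformPeterssonSizeCMReductionProofs` reduce the fact to
an abstract pair datum `P i j` (holomorphy on the ball `|s − 2| < 3/2`, a polynomial bound on the closed
ball, the positivity identity `hcoeff₃`, and a bound at `s = 1`) for the non-CM, non-twist-equivalent
pairs, plus the bound on the CM family `j = 0`. `RankinSymmSquarePairSeries` constructs the explicit
`P = symmSqPairL f_i f_j` (`= ζ(s) L(q, s) = ζ(2s)² ∏_{p∣N_iN_j}(1 − p^{−s})(1 + p^{−s})² ·
L^{(N_iN_j)}(s, Sym² f_i × Sym² f_j)` on `Re s > 1`) and PROVES `hcoeff₃` for it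
(`symmSqPairL_coeff₃`). Feeding it in:

* `murty_petersson_newform_lower_bound_of_symmSqPairL_continuation` — the named fact from
  (A) for every non-CM, non-twist-equivalent pair a function `G i j` holomorphic on `ball 2 (3/2)` which
  AGREES WITH `symmSqPairL i.f j.f` on `Re s > 1`, with `‖G i j s‖ ≤ B₂ (N_iN_j)^{κ₂}` on
  `closedBall 2 (3/2)` and `‖G i j 1‖ ≤ T(δ)(N_iN_j)^δ` — i.e. ANALYTIC CONTINUATION WITH POLYNOMIAL
  GROWTH OF ONE EXPLICIT EULER PRODUCT built from `a_p(f_i), a_p(f_j)`; and (B) a lower bound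
  `c(ε) N^{−ε} ≤ symmSqLOne f` on the CM members (any CM predicate);
* **`murty_petersson_newform_lower_bound_of_symmSqPairL_continuation_nonCM`** — the named fact from
  (A) ALONE (`CM = HasCM`): every CM member is a theorem of the tree (`j ≠ 0`:
  `NewformSymmSquareJ1728Hecke`/`NewformSymmSquareTwistClass`; `j = 0`: `NewformSymmSquareJ0Hecke`),
  through `murty_petersson_newform_lower_bound_of_pairData_nonCM'`;
* `murty_petersson_newform_lower_bound_of_exists_symmSqPairL_continuation_nonCM` — (A) in existential
  form (one continuation per pair, uniform constants).

(A) is the content of Hoffstein–Lockhart §1 for these pairs: the Gelbart–Jacquet lift (cuspidal for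
non-CM `f`, with local–global compatibility at every `p ∤ N`), the `GL₃ × GL₃` Rankin–Selberg theory
(Jacquet–Piatetski-Shapiro–Shalika; Mœglin–Waldspurger: `L(s, Π_i × Π_j)` entire for `Π_i ≇ Π_j`,
which for symmetric-square lifts of non-CM forms means "not twist-equivalent") and the convexity
bound in the conductor `≪ (N_iN_j)^B` (plus `L(1, Π_i × Π_j) ≪ (N_iN_j)^δ`). None of it has a carrier
in the tree; this file makes it the ONLY missing input of the named fact along this route, as a
statement about an explicit Dirichlet series, free of automorphic vocabulary (the alternative single
input being Goldfeld–Hoffstein–Lieman's "no exceptional zero" for the non-CM forms,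
`NewformPeterssonSizeNoExceptionalZeroReductionProofs`).

## References

* J. Hoffstein, P. Lockhart, *Coefficients of Maass forms and the Siegel zero*, Ann. of Math. 140
  (1994), Thm. 0.1 and §1. [cite: HoffsteinLockhart1994, Thm. 0.1 and §1]
* M. R. Murty, *Bounds for congruence primes*, Proc. Sympos. Pure Math. 66.1 (1999), §2 (3).
  [cite: MurtyCongruencePrimes1999, §2 (3)]
* C. Mœglin, J.-L. Waldspurger, *Le spectre résiduel de `GL(n)`*, Ann. Sci. ÉNS 22 (1989),
  Appendice, Corollaire. [cite: MoeglinWaldspurger1989, Appendice, Corollaire]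

## Mathlib / tree search

Tree: `murty_petersson_newform_lower_bound_of_pairData_nonCM` (`NewformPeterssonSizePairReductionProofs`),
`murty_petersson_newform_lower_bound_of_pairData_nonCM'` (`NewformSymmSquareJ0Hecke`),
`symmSqPairL`, `symmSqPairL_coeff₃` (`RankinSymmSquarePairSeries`), `EllipticNewformIndex`, `TwistEquiv`,
`symmSqL`, `symmSqLOne`, `WeierstrassCurve.HasCM`.
-/

noncomputable section

open scoped Real ComplexOrder
open Complex CongruenceSubgroup Metric

namespace Literature.NumberTheory.EllipticCurves.ModularForms

/-- `hcoeff₃` transfers from `symmSqPairL` to any function agreeing with it on `Re s > 1`. [folklore] -/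
theorem coeff₃_of_eqOn_symmSqPairL (i j : EllipticNewformIndex) {G : ℂ → ℂ}
    (hG : ∀ s : ℂ, 1 < s.re → G s = symmSqPairL i.f j.f s) :
    ∃ a : ℕ → ℂ, 0 ≤ a ∧ a 1 = 1 ∧ (∀ s : ℂ, 1 < s.re → LSeriesSummable a s) ∧
      ∀ s : ℂ, 1 < s.re →
        riemannZeta₁ s * (symmSqL i.N i.f s * symmSqL j.N j.f s * G s) = (s - 1) * LSeries a s := by
  obtain ⟨a, ha, ha1, hsum, hid⟩ := symmSqPairL_coeff₃ i.isNewformOf j.isNewformOf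
  exact ⟨a, ha, ha1, hsum, fun s hs ↦ by rw [hG s hs]; exact hid s hs⟩

/-- **Murty's bound from the analytic continuation of the explicit pair function, with an arbitrary
CM predicate.** Hypotheses: a predicate `CM` with the direct bound `c(ε)N^{−ε} ≤ symmSqLOne f` on its
members (model: complex multiplication; Hecke `L`-functions), and for the pairs `i, j` off `CM` which
are not twist-equivalent a function `G i j`, holomorphic on `|s − 2| < 3/2`, equal to
`symmSqPairL i.f j.f` (`= ζ(2s)² ∏_{p∣N_iN_j}(1−p^{−s})(1+p^{−s})² L^{(N_iN_j)}(s, Sym² f_i × Sym² f_j)`)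
on `Re s > 1`, polynomially bounded on the closed ball and at `s = 1`. Conclusion: the named fact.
The positivity input `hcoeff₃` is the theorem `symmSqPairL_coeff₃`.
[cite: HoffsteinLockhart1994, Thm. 0.1 and §1] [cite: MurtyCongruencePrimes1999, §2 (3)] -/
theorem murty_petersson_newform_lower_bound_of_symmSqPairL_continuation
    (CM : EllipticNewformIndex → Prop)
    (hCM : ∀ ε : ℝ, 0 < ε → ∃ c : ℝ, 0 < c ∧ ∀ j : EllipticNewformIndex, CM j →
      c * (j.N : ℝ) ^ (-ε) ≤ symmSqLOne j.f)
    (G : EllipticNewformIndex → EllipticNewformIndex → ℂ → ℂ)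
    (hGd : ∀ i j, ¬ CM i → ¬ CM j → ¬ TwistEquiv i j → DifferentiableOn ℂ (G i j) (ball (2 : ℂ) (3 / 2)))
    (hGeq : ∀ i j, ¬ CM i → ¬ CM j → ¬ TwistEquiv i j →
      ∀ s : ℂ, 1 < s.re → G i j s = symmSqPairL i.f j.f s)
    {B₂ κ₂ : ℝ} (hB₂ : 0 ≤ B₂) (hκ₂ : 0 ≤ κ₂)
    (hGle : ∀ i j, ¬ CM i → ¬ CM j → ¬ TwistEquiv i j → ∀ s ∈ closedBall (2 : ℂ) (3 / 2),
      ‖G i j s‖ ≤ B₂ * ((i.N : ℝ) * j.N) ^ κ₂)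
    (hG1 : ∀ δ : ℝ, 0 < δ → ∃ T : ℝ, ∀ i j, ¬ CM i → ¬ CM j → ¬ TwistEquiv i j →
      ‖G i j 1‖ ≤ T * ((i.N : ℝ) * j.N) ^ δ) :
    murty_petersson_newform_lower_bound :=
  murty_petersson_newform_lower_bound_of_pairData_nonCM CM hCM G hGd hB₂ hκ₂ hGle
    (fun i j hi hj hij ↦ coeff₃_of_eqOn_symmSqPairL i j (hGeq i j hi hj hij)) hG1

/-- **Murty's bound from the analytic continuation of the explicit pair function ALONE.** After this
theorem the named fact `murty_petersson_newform_lower_bound` rests, along the Siegel route, on exactly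
one input: for the non-CM, non-twist-equivalent pairs of elliptic newforms, the continuation to
`|s − 2| < 3/2` with polynomial growth (and the value bound at `1`) of the explicit Euler products
`symmSqPairL f_i f_j` (Hoffstein–Lockhart §1: Gelbart–Jacquet + `GL₃ × GL₃` Rankin–Selberg + convexity);
every CM member is a theorem of the tree (`murty_petersson_newform_lower_bound_of_pairData_nonCM'`).
[cite: HoffsteinLockhart1994, Thm. 0.1 and §1] [cite: MurtyCongruencePrimes1999, §2 (3)] -/
theorem murty_petersson_newform_lower_bound_of_symmSqPairL_continuation_nonCM
    (G : EllipticNewformIndex → EllipticNewformIndex → ℂ → ℂ)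
    (hGd : ∀ i j, ¬ i.W.HasCM → ¬ j.W.HasCM → ¬ TwistEquiv i j →
      DifferentiableOn ℂ (G i j) (ball (2 : ℂ) (3 / 2)))
    (hGeq : ∀ i j, ¬ i.W.HasCM → ¬ j.W.HasCM → ¬ TwistEquiv i j →
      ∀ s : ℂ, 1 < s.re → G i j s = symmSqPairL i.f j.f s)
    {B₂ κ₂ : ℝ} (hB₂ : 0 ≤ B₂) (hκ₂ : 0 ≤ κ₂)
    (hGle : ∀ i j, ¬ i.W.HasCM → ¬ j.W.HasCM → ¬ TwistEquiv i j → ∀ s ∈ closedBall (2 : ℂ) (3 / 2),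
      ‖G i j s‖ ≤ B₂ * ((i.N : ℝ) * j.N) ^ κ₂)
    (hG1 : ∀ δ : ℝ, 0 < δ → ∃ T : ℝ, ∀ i j, ¬ i.W.HasCM → ¬ j.W.HasCM → ¬ TwistEquiv i j →
      ‖G i j 1‖ ≤ T * ((i.N : ℝ) * j.N) ^ δ) :
    murty_petersson_newform_lower_bound :=
  murty_petersson_newform_lower_bound_of_pairData_nonCM' G hGd hB₂ hκ₂ hGle
    (fun i j hi hj hij ↦ coeff₃_of_eqOn_symmSqPairL i j (hGeq i j hi hj hij)) hG1

/-- **The same with the analytic input in existential form** (one continuation per pair, uniform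
constants): for every non-CM, non-twist-equivalent pair there EXISTS a holomorphic `g` on the ball
agreeing with `symmSqPairL i.f j.f` on `Re s > 1` with the two bounds. [cite: HoffsteinLockhart1994, Thm. 0.1 and §1] -/
theorem murty_petersson_newform_lower_bound_of_exists_symmSqPairL_continuation_nonCM
    {B₂ κ₂ : ℝ} (hB₂ : 0 ≤ B₂) (hκ₂ : 0 ≤ κ₂) (T : ℝ → ℝ)
    (h : ∀ i j : EllipticNewformIndex, ¬ i.W.HasCM → ¬ j.W.HasCM → ¬ TwistEquiv i j →
      ∃ g : ℂ → ℂ, DifferentiableOn ℂ g (ball (2 : ℂ) (3 / 2)) ∧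
        (∀ s : ℂ, 1 < s.re → g s = symmSqPairL i.f j.f s) ∧
        (∀ s ∈ closedBall (2 : ℂ) (3 / 2), ‖g s‖ ≤ B₂ * ((i.N : ℝ) * j.N) ^ κ₂) ∧
        ∀ δ : ℝ, 0 < δ → ‖g 1‖ ≤ T δ * ((i.N : ℝ) * j.N) ^ δ) :
    murty_petersson_newform_lower_bound := by
  classical
  -- choose the continuations (and anything off the relevant pairs)
  let G : EllipticNewformIndex → EllipticNewformIndex → ℂ → ℂ := fun i j ↦
    if hij : ¬ i.W.HasCM ∧ ¬ j.W.HasCM ∧ ¬ TwistEquiv i j then (h i j hij.1 hij.2.1 hij.2.2).choose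
    else fun _ ↦ 0
  have hG : ∀ i j (hi : ¬ i.W.HasCM) (hj : ¬ j.W.HasCM) (hij : ¬ TwistEquiv i j),
      G i j = (h i j hi hj hij).choose := fun i j hi hj hij ↦ by
    show (if hij : ¬ i.W.HasCM ∧ ¬ j.W.HasCM ∧ ¬ TwistEquiv i j then
      (h i j hij.1 hij.2.1 hij.2.2).choose else fun _ ↦ 0) = _
    rw [dif_pos (⟨hi, hj, hij⟩ : ¬ i.W.HasCM ∧ ¬ j.W.HasCM ∧ ¬ TwistEquiv i j)]
  refine murty_petersson_newform_lower_bound_of_symmSqPairL_continuation_nonCM G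
    (fun i j hi hj hij ↦ ?_) (fun i j hi hj hij ↦ ?_) hB₂ hκ₂ (fun i j hi hj hij ↦ ?_) (fun δ hδ ↦ ?_)
  · rw [hG i j hi hj hij]; exact (h i j hi hj hij).choose_spec.1
  · rw [hG i j hi hj hij]; exact (h i j hi hj hij).choose_spec.2.1
  · rw [hG i j hi hj hij]; exact (h i j hi hj hij).choose_spec.2.2.1
  · exact ⟨T δ, fun i j hi hj hij ↦ by rw [hG i j hi hj hij]; exact (h i j hi hj hij).choose_spec.2.2.2 δ hδ⟩

end Literature.NumberTheory.EllipticCurves.ModularForms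

end
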